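import Literature.AlgebraicGeometry.CossartPiltant200819.Thm21VerbatimReduced2008
import Literature.AlgebraicGeometry.CossartPiltant200819.Thm21Assembly2008
import Literature.AlgebraicGeometry.CossartPiltant200819.ArcDescentCore2008
import Literature.AlgebraicGeometry.CossartPiltant200819.ClimbToInertiaField2008
import Literature.AlgebraicGeometry.CossartPiltant200819.RankReduction2008
import HarnessLib

/-!
# Cossart–Piltant 2008, Thm. 2.1 — the dependency statement down to printed leaves and residuals

[CP-I] = V. Cossart, O. Piltant, *Resolution of singularities of threefolds in positive
characteristic I*, J. Algebra 320 (2008) 1051–1082 (HAL hal-00139124; HAL numbering used below: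
HAL Prop. 8.3 / Prop. 9.3 / Lemma 9.4 / Prop. 9.5 = journal Prop. 6.3 / Prop. 9.1 / Lemma 9.2 /
Prop. 9.3); [CP-II] = part II, J. Algebra 321 (2009) 1836–1976 (`CossartPiltant2009Main`);
[CP-2019] = V. Cossart, O. Piltant, *Resolution of singularities of arithmetical threefolds*,
J. Algebra 529 (2019) (`CossartPiltant2019Principalization` = its Prop. 4.4); [CJS] =
Cossart–Jannsen–Saito (arXiv:0905.2191); [Fu1997] D. Fu, J. Algebra 194 (1997) Thm. 3.6;
[BPR2022] Benito–Piltant–Reguera, J. Pure Appl. Algebra 226 (2022) Prop. 2.3; [KK2009]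
Knaf–Kuhlmann, Adv. Math. 221 (2009) Thm. 1.5.

Bookkeeping only (one-line compositions, no new mathematics).  The tree's assemblies of [CP-I]
Thm. 2.1 take HAL Lemma 9.4 as the leaf `h94 : TamePrimeDescent`; the directory has meanwhile
analysed that lemma down to `tamePrimeDescent_of_printed_leaves_cases` (`ArcDescent2008.lean`):
Prop. 9.3 (`DescentBelowInertiaField`), the valid part of the printed proof
(`TamePrimeDescentViaStableModel`, HAL p. 30 l. 16–65), Cor. 4.6 (`Cofinality`), the transport of
[Fu1997] Thm. 3.6 (`PrimaryTransformRankOne`), [BPR2022] Prop. 2.3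
(`BenitoPiltantReguera2022QuadraticSequence`) and the two RESIDUAL sub-cases of the stability
statement (S3\*) which the printed text uses at HAL p. 30 l. 14–16 without proof
(`GStableUniformizationInertialRankOneNonDiscrete`, `GStableUniformizationInertialRankOneDiscreteImperfect`;
in universe `0` the second shrinks to `GStableUniformizationInertialRankOneDiscreteImperfectCore`
by [KK2009] Thm. 1.5, `tamePrimeDescent_of_printed_leaves_cases₀`).  With Prop. 5.1
(`rankReduction_of_cjs`), Cor. 6.3 (`climbToInertiaField_of_principalization`) and Cor. 4.6
(`cofinality_of_principalization`) now derived, this module writes the top statements of [CP-I]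
as single theorems whose hypotheses are EXACTLY: the printed propositions still taken as leaves
(Prop. 4.9, Prop. 4.2 in the form [CP-2019] Prop. 4.4, Prop. 8.3, Prop. 9.3, the valid part of
the proof of Lemma 9.4), the cited external theorems ([CP-II], [CJS], [Fu1997] transported,
[BPR2022], in universe `0` also [KK2009]) and the residual sub-cases of (S3\*).  Nothing here
asserts any of these hypotheses.
-/

universe u

namespace Literature.AlgebraicGeometry.CossartPiltant200819.CP2008

open Literature.AlgebraicGeometry.Resolution

/-- **HAL Lemma 9.4 (`TamePrimeDescent`) from Prop. 4.2 ([CP-2019] Prop. 4.4), Prop. 9.3, the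
valid part of its printed proof, [Fu1997] transported, [BPR2022] Prop. 2.3 and the two residual
sub-cases of (S3\*)** — `tamePrimeDescent_of_printed_leaves_cases` with Cor. 4.6 supplied by
`cofinality_of_principalization`.
[cite: CossartPiltant2008, Lemma 9.4 (HAL pp. 29–30), Cor 4.6 (HAL p. 15)]
[cite: BenitoPiltantReguera2022, Prop. 2.3 (HAL hal-01945228v1 p. 7)] -/
theorem tamePrimeDescent_of_principalization_of_cases
    (hP : CossartPiltant2019Principalization.{u}) (h93 : DescentBelowInertiaField.{u})
    (h94v : TamePrimeDescentViaStableModel.{u}) (hFu : PrimaryTransformRankOne.{u})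
    (hBPR : BenitoPiltantReguera2022QuadraticSequence.{u})
    (hnd : GStableUniformizationInertialRankOneNonDiscrete.{u})
    (hdi : GStableUniformizationInertialRankOneDiscreteImperfect.{u}) : TamePrimeDescent.{u} :=
  tamePrimeDescent_of_printed_leaves_cases h93 h94v (cofinality_of_principalization hP) hFu hBPR
    hnd hdi

/-- **[CP-I] Thm. 2.1 VERBATIM for reduced quasi-projective threefolds — the full dependency
statement.**  Hypotheses, in order: Prop. 4.9 verbatim (`RefinedPatchingQuasiProjective`);
Prop. 4.2 as [CP-2019] Prop. 4.4 (`CossartPiltant2019Principalization`); Prop. 8.3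
(`PrimeDegreeAscent`); Prop. 9.3 (`DescentBelowInertiaField`); the valid part of the proof of
Lemma 9.4 (`TamePrimeDescentViaStableModel`); [Fu1997] Thm. 3.6 transported
(`PrimaryTransformRankOne`); [BPR2022] Prop. 2.3; the two residual sub-cases of (S3\*); [CP-II]
(`CossartPiltant2009Main`); [CJS] embedded resolution (`CossartJannsenSaito2020Embedded`, =
[CP-I] Prop. 4.1); [CJS] Thm. 1 (`CossartJannsenSaito2020Sequence`, = [CP-I]'s [36]).  Proof:
`resolutionQuasiProjectiveThreefolds_of_leaves'` with `p51 := rankReduction_of_cjs h36.general`,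
`h63 := climbToInertiaField_of_principalization hP`,
`h94 := tamePrimeDescent_of_principalization_of_cases …`.
[cite: CossartPiltant2008, Thm 2.1 (HAL p. 3)] [cite: CossartPiltant2009, Theorem (p. 1839)]
[cite: CossartJannsenSaito2020, Introduction Thm. 1, Thm. 1.2] -/
theorem resolutionQuasiProjectiveThreefolds_of_printedLeaves_residuals
    (h49 : RefinedPatchingQuasiProjective.{u}) (hP : CossartPiltant2019Principalization.{u})
    (h83 : PrimeDegreeAscent.{u}) (h93 : DescentBelowInertiaField.{u})
    (h94v : TamePrimeDescentViaStableModel.{u}) (hFu : PrimaryTransformRankOne.{u})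
    (hBPR : BenitoPiltantReguera2022QuadraticSequence.{u})
    (hnd : GStableUniformizationInertialRankOneNonDiscrete.{u})
    (hdi : GStableUniformizationInertialRankOneDiscreteImperfect.{u})
    (cp2 : CossartPiltant2009Main.{u}) (hE : CossartJannsenSaito2020Embedded.{u})
    (h36 : CossartJannsenSaito2020Sequence.{u}) : ResolutionQuasiProjectiveThreefolds.{u} :=
  resolutionQuasiProjectiveThreefolds_of_leaves' h49 (rankReduction_of_cjs h36.general)
    (climbToInertiaField_of_principalization hP) h83 h93
    (tamePrimeDescent_of_principalization_of_cases hP h93 h94v hFu hBPR hnd hdi) cp2 hE h36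

/-- **Both halves of the 2008 programme's top statement (affine rendering of Thm. 2.1 and (LU)
for differentially finite ground fields) — the full dependency statement**: `cp2008_of_leaves`
with Prop. 5.1, Cor. 6.3 and Lemma 9.4 expanded as in
`resolutionQuasiProjectiveThreefolds_of_printedLeaves_residuals` (here with Prop. 4.9 in the affine
form `RefinedPatching` and [36] in the weak form `CossartJannsenSaito2020General`).
[cite: CossartPiltant2008, Thm 2.1 and Thm 7.2 (HAL pp. 3–4)] [cite: CossartPiltant2009, Theorem (p. 1839)]
[cite: CossartJannsenSaito2020, Thm. 1.2] -/
theorem cp2008_of_printedLeaves_residuals (p49 : RefinedPatching.{u})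
    (hP : CossartPiltant2019Principalization.{u}) (h83 : PrimeDegreeAscent.{u})
    (h93 : DescentBelowInertiaField.{u}) (h94v : TamePrimeDescentViaStableModel.{u})
    (hFu : PrimaryTransformRankOne.{u}) (hBPR : BenitoPiltantReguera2022QuadraticSequence.{u})
    (hnd : GStableUniformizationInertialRankOneNonDiscrete.{u})
    (hdi : GStableUniformizationInertialRankOneDiscreteImperfect.{u})
    (cp2 : CossartPiltant2009Main.{u}) (h36 : CossartJannsenSaito2020General.{u})
    (p41 : CossartJannsenSaito2020Embedded.{u}) :
    ResolutionAffineThreefolds.{u} ∧ LU3DiffFinite.{u} :=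
  cp2008_of_leaves p49 (rankReduction_of_cjs h36) (climbToInertiaField_of_principalization hP)
    h83 h93 (tamePrimeDescent_of_principalization_of_cases hP h93 h94v hFu hBPR hnd hdi) cp2
    h36 p41

/-- **[CP-I] Thm. 2.1 VERBATIM (reduced quasi-projective threefolds), universe `0` — the sharpest
dependency statement of the directory**: as
`resolutionQuasiProjectiveThreefolds_of_printedLeaves_residuals`, with the discrete-imperfect
residual shrunk to its CORE ("`W` discrete, `k` imperfect, `κ(V)/k` not finite separable") by
[KK2009] Thm. 1.5 (`KnafKuhlmann2009MonogenicCompletion`, `tamePrimeDescent_of_printed_leaves_cases₀`).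
[cite: CossartPiltant2008, Thm 2.1 (HAL p. 3)] [cite: KnafKuhlmann2009, Thm. 1.5]
[cite: CossartJannsenSaito2020, Introduction Thm. 1, Thm. 1.2] -/
theorem resolutionQuasiProjectiveThreefolds_of_printedLeaves_residuals₀
    (h49 : RefinedPatchingQuasiProjective.{0}) (hP : CossartPiltant2019Principalization.{0})
    (h83 : PrimeDegreeAscent.{0}) (h93 : DescentBelowInertiaField.{0})
    (h94v : TamePrimeDescentViaStableModel.{0}) (hFu : PrimaryTransformRankOne.{0})
    (hKK : KnafKuhlmann2009MonogenicCompletion)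
    (hBPR : BenitoPiltantReguera2022QuadraticSequence.{0})
    (hnd : GStableUniformizationInertialRankOneNonDiscrete.{0})
    (hdic : GStableUniformizationInertialRankOneDiscreteImperfectCore)
    (cp2 : CossartPiltant2009Main.{0}) (hE : CossartJannsenSaito2020Embedded.{0})
    (h36 : CossartJannsenSaito2020Sequence.{0}) : ResolutionQuasiProjectiveThreefolds.{0} :=
  resolutionQuasiProjectiveThreefolds_of_leaves' h49 (rankReduction_of_cjs h36.general)
    (climbToInertiaField_of_principalization hP) h83 h93
    (tamePrimeDescent_of_printed_leaves_cases₀ h93 h94v (cofinality_of_principalization hP) hFu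
      hKK hBPR hnd hdic) cp2 hE h36

end Literature.AlgebraicGeometry.CossartPiltant200819.CP2008
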